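import Summits.PneNP.PneNP.Theorems.SzkEntropyPeaWorstToAvgReductions
import Summits.PneNP.PneNP.Theorems.SzkEntropyPeaWorstToAvgDualModeCard
import Literature.Computability.Cryptography.LWEHardness
import Literature.Computability.Cryptography.IndistinguishabilityProofs

/-!
# Line `lattice-import-trapdoor-support` — crux `SzkEntropy.PeaWorstToAvg` (stmt-PneNP-10777)

Skeleton of the line (crux-plan, planner-cruxplan-stmt-PneNP-10777-lattice-import-trapd-0, 2026-08-16) for
the crux idea `lattice-import-trapdoor-support` (crux-ideate r1, ideator 2; triage r1: k1 fail · k2 fail ·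
k3 pass — the two fails are against the card's TRANSFER residual, not its mechanism; this skeleton replaces
that residual, see STUB 1). Line card: `Lines/lattice-import-trapdoor-support.md`.

THE CRUX (`Summit.PneNP.PneNP.Theses.SzkEntropy.PeaWorstToAvg`, defeq `Theorems.szkEntropy_peaWorstToAvg_iff`):
`A → C` with `A := PEA 3 ∉ PromiseBPP'` and
`C := ∃ D, D.IsPolySamplable ∧ (∀ n, supp Dₙ ⊆ (PEA 3).yes ∪ (PEA 3).no) ∧ ((PEA 3).yes, D) ∉ HeurBPP`.

THE LINE. LWE parameters `(q = 2^{logq}, m, α; r, R)` indexed by the LWE dimension `n`; three stubs.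

* STUB 2 `stub_trapdoor_certified_modes` (K2' of the card — its MECHANISM; an UNCONDITIONAL lattice
  theorem, L–XL): for some parameters in the BLPRS regime with the Karp gap there are polynomial-time
  samplable ensembles of LWE-sample codes, `K₁` supported on CLOSE instances (`dist(b, Λ_q(A)) ≤ r`) and `K₀`
  on WELL-SPREAD-and-FAR instances (`λ₁(Λ_q(A)) ≥ R`, `s ↦ As` injective, `dist(b, Λ_q(A)) ≥ R`) — supports
  EXACTLY on the promise of `CertBDD`, at every `n` — and STATISTICALLY close to the honest LWE ensemble
  `(A, As+e)` resp. the uniform ensemble `(A, u)`.  How: Micciancio–Peikert trapdoor generation (`A` within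
  negligible distance of uniform by the leftover hash lemma; EVERY sampled `A = [Ā | G − ĀT]` carries a basis
  of `Λ_q^⊥(A)` with Gram–Schmidt norms `≤ L = O(√(n·logq))`, so by the reversed dual basis
  (`Literature.Algebra.EuclideanLattices.norm_gramSchmidt_dual_rev`, Peikert 2009 Lemma 2.3) the primal
  `Λ_q(A) = q·Λ_q^⊥(A)^*` has a basis with Gram–Schmidt minimum `≥ q/L ≥ 2R`: well-spreadness ALWAYS holds and
  Babai decodes/certifies up to radius `R`); YES instances `(A, As+e)`, `e ← Ψ̄_α^m` TRUNCATED to `‖e‖ ≤ r`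
  (tail `2^{-Ω(m)}`; triage r1-3 sharpen (2)); NO instances `(A, u)`, `u` uniform, EMITTED ONLY IF Babai's
  residual is `≥ R` (`Literature.Algebra.EuclideanLattices.Babai.le_infDist_of_le_residual`, landed for this
  card), which fails with probability `≤ |ℤ^m ∩ B_R|/q^{m-n}` = negligible for `m ≥ 2n·logq`, and otherwise
  the DETERMINISTIC far point `u* = (q/2)·eᵢ` (`⟨u* − v, t⟩ ≡ q/2 (mod q)` for a trapdoor row `t ∋ ±1`, so
  `dist ≥ q/(2‖t‖) ≥ R`).  Window (triage r1-1/2/3 checked the card's version on paper; re-derived here for the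
  shift-sampler gap): `q = 2^{logq} ≈ n⁶`, `α = (n+2)⁻⁵` (`αq ≈ n ≥ √n·log n`), `m = 3(n+2)·logq` (leftover hash with
  `m̄ = n·logq + 2n`), `r = ⌈αq√m⌉ = Õ(n^{1.5})`, `R = 64·m·r = Õ(n^{2.5}) ≤ q/(2L) = Õ(n^{5.5})` (`L = O(√(n·logq))` the
  trapdoor Gram–Schmidt bound, CHECKED at sampling time, fallback otherwise); all conditions are needed only
  eventually — small `n` are served by explicit instances (gadget lattice `Λ_q(I ⊗ (1,2,…,q/2))`, `λ₁ = q/2`),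
  since statistical closeness is asymptotic while the support conditions hold for every coin at every `n`.
* STUB 3 `stub_certBDD_karp_to_pea` (K1', L–XL): `CertBDD ≤ₚ PEA 3` by the DIRECT Karp route recommended by
  triage (r1-1 caution (c), r1-3 sharpen (1); NOT the card's `GapCVP → PED →(2-query tt) PEA` route, whose
  truth-table step need not stay on the promise): on `(A, b)` output the degree-3 AIK encoding of the 4-fold
  SHIFT SAMPLER `(s, e', c) ↦ As + e' + c·b (mod q)` — `s ∈ ℤ_qⁿ` from `n·logq` uniform bits (q is a power of
  two), box noise `e' ∈ [-β, β)^m` from `m·log₂(2β)` bits with `β` the least power of two `≥ 4√m·r`, one bit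
  `c` — with threshold `k* = 4(n·logq + m·log₂(2β)) + 1 + |encoding randomness|`.  WELL-SPREAD ∧ FAR ⇒ the two
  `c`-translates have disjoint supports and `(s, e') ↦ As + e'` is injective (`2β√m ≤ 16mr < R`), so
  `H = 4(n·logq + m·log₂(2β) + 1) ≥ k* + 1`; CLOSE (`b = As₀ + e₀`, `‖e₀‖ ≤ r`) ⇒
  `Δ(Y|c=0, Y|c=1) ≤ ‖e₀‖₁/(2β) ≤ 1/8` and `H(Y) ≤ H(Y|c) + I(c;Y) ≤ n·logq + m·log₂(2β) + 1/8`
  (`I ≤ Δ` since `h(p) ≥ 2 min(p,1-p)`), so `H ≤ k* - 1/2`; the sampler is logspace (iterated addition mod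
  `2^k`), and the AIK perfect randomized encoding of a branching program is a degree-3 map over `F₂` whose
  entropy exceeds the sampler's by exactly its randomness length (DGRV Thm. 4.5 / proof of Thm. 4.6 — the
  same compile step as route item `PeaDegreeReduction`, stmt-PneNP-10780).  Degenerate headers map to fixed
  instances.
* STUB 1 `stub_pea_hard_captures_dlwe` (closing residual, XL⁺, OPEN — HARDEST): for all parameters in the
  BLPRS regime, `PEA 3 ∉ PromiseBPP' → decision-LWE is hard` (honest LWE codes ≈_c uniform codes).
  Contrapositive: ONE polynomial-time LWE distinguisher anywhere in the regime puts `PEA₃` — hence `SZKP_L`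
  (QR, DDH, GI, `GapCVP_√n`) — in `PromiseBPP'`.  This REPLACES the card's residual
  "(GapSVP easy ∧ PEA₃ hard) → C", graded COSTUME by triage r1-1/r1-2 (the crux restricted to a sub-world,
  not eased); the replacement implies that costume as soon as a `GapSVP_γ` algorithm breaks decision-LWE at these
  parameters (`γ ≤ Õ(1/α)`: `BDD ≤ uSVP_γ ≤ GapSVP_γ`, Lyubashevsky–Micciancio 2009), is NOT a restatement of the crux
  (worst-case → LWE-average-case, no ensemble on cubic maps), and is the LWE-pivoted (weakest) form of the
  reduction residual R1 `PEA₃ ≤_{BPP-T} GapSVP_poly` of the sibling card `lossy-mode-compilation`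
  (DGRV p. 3, approach (1)), which triage r1-2/r1-3 passed as "not a costume": R1 ⇒ STUB 1 through
  `Literature.Computability.Cryptography.blprs_gapSVP_sqrt_dim_to_lwe_classical` (BLPRS 2013 Thm. 1.1, named
  fact) + `regev_decision_to_search_holds`.  Its conclusion is the standard LWE assumption, so nothing known
  refutes it; no mechanism is claimed (the bet of every line on this crux, cf. triage cross-cutting remark).

COMPOSITION `PeaWorstToAvg_of` (kernel-checked, no `sorry`): `A` —STUB 1→ `LWE ≈_c U` at STUB 2's
parameters; `K₀ ≈ₛ U ≈_c LWE ≈ₛ K₁` (`IsStatisticallyClose.isCompIndistinguishable_holds`,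
`IsCompIndistinguishable.trans_holds`) ⇒ `K₀ ≈_c K₁`; the LANDED dual-mode lemma
`Theorems.not_mem_HeurBPP_of_isCompIndistinguishable` (p71078) + `Ensemble.isPolySamplable_mixEnsemble` (p70907)
make `(CertBDD.yes, ½K₀+½K₁)` samplable, on-promise and `HeurBPP`-hard; STUB 3 + the LANDED push-forward
`Theorems.peaWorstToAvg_of_hard_reducible` (p71914, this card's first lemmas) conclude the crux BY NAME.

DISPROOF.LEAN (`Cruxes/PeaWorstToAvg/Disproof.lean`, generation 2 / cycle 2, 2026-08-16) HONOURED: it has NO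
`_false_without_<H>` theorem and `-- Targets: none yet` (§2: the crux has one hypothesis; a refutation proves the
summit), so nothing is to be honoured by name; §1 `not_peaWorstToAvg_iff` (¬S = SZK-Heuristica for PEA₃) — the
line USES `A`, at STUB 1; §4 `not_forall_ensembles`, `mem_HeurBPP_of_support_subset_no/_yes`,
`exists_yes_and_no_of_hard` (∀-D version false; one-sided ensembles easy; a hard `D` must be a PLANTED TWO-SIDED
family, unreachable by re-randomising one map) — the ensemble here is exactly such a family: the ½/½ mixture of
certified-YES and certified-NO lattice modes carried into `PEA₃` by a Karp map; §3(b) `detHyp_iff` — the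
`PromiseBPP'` hypothesis is kept; §5 advice asymmetry (`not_peaWorstToAvg_of_promiseScheme`) — absorbed by the
landed `exists_padded_simulator` in the composition, and present inside STUB 1 only as the usual
`RandAlg`-with-coin-budget reading of "PPT distinguisher"; §6 printed negatives (OW93, BDV, GST07, relativised
Heuristica) — not engaged (no OWF assumed, no diagonalisation, no orbit re-randomisation).  Landed
`Theorems/…/Negative/`: none (`ledger negatives --problem PneNP`: 5 items, none about lattices/LWE/PEA ensembles).

REGISTRATION DEVICE (as `Summits/ABC/ABC/Cruxes/MazurKaneLaw/Lines/*.lean`): the registered `stub_*`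
signatures are INLINED over tree declarations only (fully qualified, `let`-free, < 3900 chars) so that a
Theorems-side `propose --supports stmt-PneNP-10777` proof can restate them textually without importing this
file; the readable vocabulary (`InRegime`, `Separated`, `CertBDD`, `DLWEHard`, …) is DEFINITIONALLY the same
(`*_holds` below), and `Registered.stub_*` are the name-keyed aliases taken as hypotheses of `PeaWorstToAvg_of`.

References: Dvir–Gutfreund–Rothblum–Vadhan, ECCC TR10-160 / ICS 2011, Thm. 1.1, Thm. 4.5–4.6, §4.4, p. 3
[DvirGutfreundRothblumVadhan2010]; Micciancio–Peikert, EUROCRYPT 2012, Thm. 5.1, Lemma 5.3, §5.4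
[MicciancioPeikert2012]; Gentry–Peikert–Vaikuntanathan, STOC 2008, §5; Babai 1986, §3 [Babai1986];
Peikert, STOC 2009, Lemma 2.3, Thm. 3.1 [Peikert2009]; Brakerski–Langlois–Peikert–Regev–Stehlé, STOC 2013,
Thm. 1.1 [BrakerskiEtAl2013]; Regev, J. ACM 2009, §4, Lemmas 4.1–4.2 [Regev2009]; Applebaum–Ishai–Kushilevitz,
SICOMP 36 (2006), Thm. 4.3 [ApplebaumIshaiKushilevitz2006]; Goldreich–Sahai–Vadhan, CRYPTO 1999 (EA);
Bogdanov–Trevisan, FnT-TCS 2006, Def. 2.1, 2.12–2.13, Lemma 3.2 [BogdanovTrevisan2006]; Goldreich 2001,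
Def. 3.2.2, §3.2.3 [Goldreich2001].
-/

noncomputable section

namespace Summit.PneNP.PneNP.Cruxes.PeaWorstToAvg.LatticeImportTrapdoorSupport

open Literature.Computability.Complexity Literature.Computability.MetaComplexity
open Literature.Computability.Cryptography (IsCompIndistinguishable IsStatisticallyClose
  encodeLWESamples IsPolyTimeParams)
open Literature.Computability.Cryptography.LWE (lweSamplesUniformSecret uniformSamples
  discretizedGaussian)
open _root_.Computability Filter
open scoped BigOperators

/-! ## Readable vocabulary (documentation; the registered stubs below inline exactly these bodies) -/

/-- **BLPRS regime** for `(q = 2^logq, m, α)` (hypothesis shape of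
`Literature.Computability.Cryptography.blprs_gapSVP_sqrt_dim_to_lwe_classical` with exponent `k = 1`):
`q`, `m` polynomially bounded, `(q, α, m)` polynomial-time computable from `1ⁿ`, eventually `0 < α < 1` and
`α·q ≥ √n·log n`.  Here decision-`LWE_{q,Ψ̄_α,m}` is classically as hard as worst-case `GapSVP_poly` in
dimension `√n`. [BrakerskiEtAl2013, Thm. 1.1; Regev2009, §4] -/
def InRegime (logq m : ℕ → ℕ) (α : ℕ → ℝ) : Prop :=
  (Literature.Computability.Cryptography.LWE.IsPolyBounded (fun n => 2 ^ logq n) ∧ Literature.Computability.Cryptography.LWE.IsPolyBounded m ∧ Literature.Computability.Cryptography.IsPolyTimeParams (fun n => 2 ^ logq n) α m ∧ ∀ᶠ n : ℕ in Filter.atTop, 0 < α n ∧ α n < 1 ∧ Real.sqrt (n : ℝ) * Real.log (n : ℝ) ≤ α n * ((2 ^ logq n : ℕ) : ℝ))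

/-- **Karp gap** for `(m; r, R)`: `1 ≤ r`, `1 ≤ m`, `64·m·r ≤ R` at every `n`, and `r` polynomial-time
computable from `1ⁿ` (the reduction of STUB 3 computes the box width `β ≥ 4√m·r` and the threshold). -/
def Separated (m r R : ℕ → ℕ) : Prop :=
  ((∀ n : ℕ, 1 ≤ r n ∧ 1 ≤ m n ∧ 64 * m n * r n ≤ R n) ∧ Literature.Computability.Complexity.PolyTimeComputable Computability.unaryEncodeNat Computability.encodeNat r)

/-- CLOSE codes: `encodeLWESamples (A, b)` (self-describing header `n`, `q`) with `b = As + e (mod q)` for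
some secret `s` and INTEGER error `‖e‖₂ ≤ r n`, i.e. `dist(b, Λ_q(A)) ≤ r n`. -/
def yesSet (logq m r : ℕ → ℕ) : Set (List Bool) :=
  {w : List Bool | ∃ (n : ℕ) (S : Fin (m n) → (Fin n → ZMod (2 ^ logq n)) × ZMod (2 ^ logq n)), (∃ (s : Fin n → ZMod (2 ^ logq n)) (e : Fin (m n) → ℤ), (∀ j, (S j).2 = (∑ i, (S j).1 i * s i) + ((e j : ℤ) : ZMod (2 ^ logq n))) ∧ (∑ j, ((e j : ℤ) : ℝ) ^ 2) ≤ ((r n : ℕ) : ℝ) ^ 2) ∧ w = Literature.Computability.Cryptography.encodeLWESamples S}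

/-- WELL-SPREAD-and-FAR codes: the only point of `Λ_q(A) = {y ∈ ℤ^m : y ≡ As}` of norm `< R n` is `0`, arising
only from `s = 0` (so `λ₁(Λ_q(A)) ≥ R n` and `s ↦ As` is injective — certified from the trapdoor), and every
representation `b = As + e` has `‖e‖₂ ≥ R n` (`dist(b, Λ_q(A)) ≥ R n` — certified by Babai's residual). -/
def noSet (logq m R : ℕ → ℕ) : Set (List Bool) :=
  {w : List Bool | ∃ (n : ℕ) (S : Fin (m n) → (Fin n → ZMod (2 ^ logq n)) × ZMod (2 ^ logq n)), (∀ (s : Fin n → ZMod (2 ^ logq n)) (e : Fin (m n) → ℤ), (∀ j, ((e j : ℤ) : ZMod (2 ^ logq n)) = ∑ i, (S j).1 i * s i) → (∑ j, ((e j : ℤ) : ℝ) ^ 2) < ((R n : ℕ) : ℝ) ^ 2 → s = 0 ∧ e = 0) ∧ (∀ (s : Fin n → ZMod (2 ^ logq n)) (e : Fin (m n) → ℤ), (∀ j, (S j).2 = (∑ i, (S j).1 i * s i) + ((e j : ℤ) : ZMod (2 ^ logq n))) → ((R n : ℕ) : ℝ) ^ 2 ≤ (∑ j, ((e j : ℤ)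 : ℝ) ^ 2)) ∧ w = Literature.Computability.Cryptography.encodeLWESamples S}

/-- **`CertBDD`** — the certified gap-`BDD` promise problem on `q`-ary lattices: YES = close codes, NO =
well-spread-and-far codes that are not close (for `r < R` the subtraction removes nothing; it makes
disjointness definitional).  `GapCVP_{R/r}` restricted to `q`-ary lattices with a `λ₁`-promise on the NO side:
the promise problem on which the trapdoor sampler of STUB 2 lands EXACTLY. -/
def CertBDD (logq m r R : ℕ → ℕ) : PromiseProblem :=
  ⟨yesSet logq m r, noSet logq m R \ yesSet logq m r⟩

/-- A promise problem whose NO side is cut down by its YES side is disjoint. -/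
theorem disjoint_mk_sdiff (Y N : Set (List Bool)) : (PromiseProblem.mk Y (N \ Y)).Disjoint := by
  change _root_.Disjoint Y (N \ Y)
  exact disjoint_sdiff_self_right

/-- `CertBDD` is disjoint (by construction). -/
theorem certBDD_disjoint (logq m r R : ℕ → ℕ) : (CertBDD logq m r R).Disjoint :=
  disjoint_mk_sdiff _ _

/-- The honest LWE ensemble: codes of `m n` samples from `A_{s,Ψ̄_α}`, uniform secret `s ∈ ℤ_qⁿ`. [Regev2009, §4] -/
def lweIdeal (logq m : ℕ → ℕ) (α : ℕ → ℝ) : Ensemble :=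
  (fun n : ℕ => (Literature.Computability.Cryptography.LWE.lweSamplesUniformSecret (Literature.Computability.Cryptography.LWE.discretizedGaussian (2 ^ logq n) (α n)) (m n) : PMF (Fin (m n) → (Fin n → ZMod (2 ^ logq n)) × ZMod (2 ^ logq n))).map Literature.Computability.Cryptography.encodeLWESamples)

/-- The uniform ensemble: codes of `m n` uniform pairs from `ℤ_qⁿ × ℤ_q`. [Regev2009, §4] -/
def unifIdeal (logq m : ℕ → ℕ) : Ensemble :=
  (fun n : ℕ => (Literature.Computability.Cryptography.LWE.uniformSamples (Fin n) (ZMod (2 ^ logq n)) (m n)).map Literature.Computability.Cryptography.encodeLWESamples)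

/-- **Decision-LWE hardness** at `(q = 2^logq, Ψ̄_α, m)` against uniform PPT distinguishers: the honest LWE
ensemble and the uniform ensemble are computationally indistinguishable. [Regev2009, §4; Goldreich2001, Def. 3.2.2] -/
def DLWEHard (logq m : ℕ → ℕ) (α : ℕ → ℝ) : Prop :=
  IsCompIndistinguishable (lweIdeal logq m α) (unifIdeal logq m)

/-- Statement of STUB 1 (readable form). -/
def CaptureStmt : Prop :=
  ∀ (logq m : ℕ → ℕ) (α : ℕ → ℝ), InRegime logq m α → PEA 3 ∉ PromiseBPP' → DLWEHard logq m α

/-- Statement of STUB 2 (readable form). -/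
def ModesStmt : Prop :=
  ∃ (logq m : ℕ → ℕ) (α : ℕ → ℝ) (r R : ℕ → ℕ), InRegime logq m α ∧ Separated m r R ∧
    ∃ K₀ K₁ : Ensemble, K₀.IsPolySamplable ∧ K₁.IsPolySamplable ∧
      (∀ t : ℕ, ∀ w ∈ (K₀ t).support, w ∈ (CertBDD logq m r R).no) ∧
      (∀ t : ℕ, ∀ w ∈ (K₁ t).support, w ∈ (CertBDD logq m r R).yes) ∧
      IsStatisticallyClose K₀ (unifIdeal logq m) ∧ IsStatisticallyClose K₁ (lweIdeal logq m α)

/-- Statement of STUB 3 (readable form). -/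
def KarpStmt : Prop :=
  ∀ (logq m r R : ℕ → ℕ), Separated m r R → (CertBDD logq m r R).PolyTimeReducible (PEA 3)

/-! ## The registered stubs (`sorry` lives only here; signatures inlined over tree declarations, fully
qualified and `let`-free, so that `propose --supports stmt-PneNP-10777` proofs can restate them textually) -/

/-- **STUB 1 · `stub_pea_hard_captures_dlwe`** (XL⁺, OPEN — the closing residual; HARDEST; the lead holds it).
Worst-case hardness of `PEA₃` captures decision-LWE throughout the BLPRS regime: readable form `CaptureStmt` =
`∀ logq m α, InRegime logq m α → PEA 3 ∉ PromiseBPP' → DLWEHard logq m α`.  Reduction-shaped content: a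
BPP-Turing reduction from entropy approximation of cubic maps over `F₂` to decision-LWE with polynomial
power-of-two modulus and `αq ≥ √n·log n` (DGRV's approach (1), p. 3, pivoted from `GapSVP_poly` to LWE — the
weakest form: implied by `PEA₃ ≤_T GapSVP_poly` via BLPRS + Regev).  Why it might fail: no lattice encoding of
cubic structure over `F₂` is known beyond linearisation; an `SZK-Heuristica`-type world (PEA₃ hard, LWE easy)
contradicts nothing known.  Honours Disproof §1 (this is where the hypothesis `A` is used).
[DvirGutfreundRothblumVadhan2010, p. 3; BrakerskiEtAl2013, Thm. 1.1; Regev2009, §4] -/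
theorem stub_pea_hard_captures_dlwe : ∀ (logq m : ℕ → ℕ) (α : ℕ → ℝ), (Literature.Computability.Cryptography.LWE.IsPolyBounded (fun n => 2 ^ logq n) ∧ Literature.Computability.Cryptography.LWE.IsPolyBounded m ∧ Literature.Computability.Cryptography.IsPolyTimeParams (fun n => 2 ^ logq n) α m ∧ ∀ᶠ n : ℕ in Filter.atTop, 0 < α n ∧ α n < 1 ∧ Real.sqrt (n : ℝ) * Real.log (n : ℝ) ≤ α n * ((2 ^ logq n : ℕ) : ℝ)) → Literature.Computability.Complexity.PEA 3 ∉ Literature.Computability.Complexity.PromiseBPP' → Literature.Computability.Cryptography.IsCompIndistinguishable (fun n : ℕ => (Literature.Computability.Cryptography.LWE.lweSamplesUniformSecret (Literature.Computability.Cryptography.LWE.discretizedGaussian (2 ^ logq n) (α n)) (m n) : PMF (Fin (m n) → (Fin n → ZMod (2 ^ logq n)) × ZMod (2 ^ logq n))).map Literature.Computability.Cryptography.encodeLWESamples) (fun n : ℕ => (Literature.Computability.Cryptography.LWE.uniformSamples (Fin n) (ZMod (2 ^ logq n)) (m n)).map Literature.Computability.Cryptography.encodeLWESamples) := by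
  sorry

/-- **STUB 2 · `stub_trapdoor_certified_modes`** (L–XL, PROVABLE — the card's mechanism; an unconditional
lattice theorem).  Readable form `ModesStmt`: parameters in the BLPRS regime with the Karp gap, and
polynomial-time samplable `K₀ ⊆ CertBDD.no`, `K₁ ⊆ CertBDD.yes` (at EVERY index `t`), statistically close to
the uniform resp. honest-LWE code ensembles.  The work: (a) MP12 trapdoor generation `A = [Ā | G − ĀT]`,
`T ← {0,±1}`, gadget `G` (so `s ↦ As` injective and a basis `S_A` of `Λ_q^⊥(A)` with `‖S̃_A‖ ≤ L` for EVERY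
outcome; `A ≈ₛ` uniform by the leftover hash lemma with `m̄ ≥ n·logq + 2n`); (b) reversed dual basis of
`q·S_A^{-t}`: Gram–Schmidt minimum `≥ q/L ≥ 2R` (`norm_gramSchmidt_dual_rev`), whence WELL-SPREAD and the Babai
certificate (`Babai.le_infDist_of_le_residual`, `Babai.le_residual_iff`); (c) samplers: `K₁` = code of
`(A, As + e)`, `s` from `n·logq` bits, `e` an inversion sample of `Ψ̄_α^m` from polynomially many bits
REJECTED unless `‖e‖ ≤ r` (fallback `e = 0`) — support ⊆ CLOSE for every coin, `≈ₛ lweIdeal`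
(trapdoor distance + sampling precision + Gaussian tail `2^{-Ω(m)}`, `r = ⌈αq√m⌉`); `K₀` = code of `(A, u)`,
`u` uniform, kept iff Babai residual `≥ R`, else `u* = (q/2)eᵢ` (`dist(u*, Λ_q(A)) ≥ q/(2‖t‖) ≥ R` for a trapdoor
row `t` with a `±1` entry) — support ⊆ WELL-SPREAD ∧ FAR ∧ ¬CLOSE for every coin, `≈ₛ unifIdeal` (rejection
probability `≤ |ℤ^m ∩ B_R| · q^{-(m-n)}`); (d) `IsPolySamplable` in the `RandAlg` model (exact output law =
the ensemble BY DEFINITION of `K₀, K₁` as the samplers' laws; cf. `isPolySamplable_map`, `SamplableMixtures`).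
Window: `logq n = 6⌈log₂(n+2)⌉`, `α n = (n+2)⁻⁵`, `m n = 3(n+2)·logq n`, `r n = ⌈α q √m⌉`, `R n = 64·m n·r n`
(`≤ q n/(2 L n)` eventually; before that, and on any failed certificate, explicit gadget-lattice instances).  Leans on (tree, proved): `BabaiFarnessCertificate`,
`ReversedDualGramSchmidt`, `GPVSampler*`/`DiscreteGaussian*` tails, `StatDistBind/Compose`,
`IndistinguishabilityProofs`; NOT in tree yet: MP12 `TrapGen` (gadget trapdoor) and the leftover hash lemma
for `(Ā, ĀT)`.  [MicciancioPeikert2012, Thm. 5.1, Lemma 5.3, §5.4; GentryPeikertVaikuntanathan2008, §5;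
Babai1986, §3; Peikert2009, Lemma 2.3; Regev2009, §4] -/
theorem stub_trapdoor_certified_modes : ∃ (logq m : ℕ → ℕ) (α : ℕ → ℝ) (r R : ℕ → ℕ), (Literature.Computability.Cryptography.LWE.IsPolyBounded (fun n => 2 ^ logq n) ∧ Literature.Computability.Cryptography.LWE.IsPolyBounded m ∧ Literature.Computability.Cryptography.IsPolyTimeParams (fun n => 2 ^ logq n) α m ∧ ∀ᶠ n : ℕ in Filter.atTop, 0 < α n ∧ α n < 1 ∧ Real.sqrt (n : ℝ) * Real.log (n : ℝ) ≤ α n * ((2 ^ logq n : ℕ) : ℝ)) ∧ ((∀ n : ℕ, 1 ≤ r n ∧ 1 ≤ m n ∧ 64 * m n * r n ≤ R n) ∧ Literature.Computability.Complexity.PolyTimeComputable Computability.unaryEncodeNat Computability.encodeNat r) ∧ ∃ K₀ K₁ : Literature.Computability.MetaComplexity.Ensemble, K₀.IsPolySamplable ∧ K₁.IsPolySamplable ∧ (∀ t : ℕ, ∀ w ∈ (K₀ t).support, w ∈ {w : List Bool | ∃ (n : ℕ) (S : Fin (m n) → (Fin n → ZMod (2 ^ logq n)) × ZMod (2 ^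 logq n)), (∀ (s : Fin n → ZMod (2 ^ logq n)) (e : Fin (m n) → ℤ), (∀ j, ((e j : ℤ) : ZMod (2 ^ logq n)) = ∑ i, (S j).1 i * s i) → (∑ j, ((e j : ℤ) : ℝ) ^ 2) < ((R n : ℕ) : ℝ) ^ 2 → s = 0 ∧ e = 0) ∧ (∀ (s : Fin n → ZMod (2 ^ logq n)) (e : Fin (m n) → ℤ), (∀ j, (S j).2 = (∑ i, (S j).1 i * s i) + ((e j : ℤ) : ZMod (2 ^ logq n))) → ((R n : ℕ) : ℝ) ^ 2 ≤ (∑ j, ((e j : ℤ) : ℝ) ^ 2)) ∧ w = Literature.Computability.Cryptography.encodeLWESamples S} \ {w : List Bool | ∃ (n : ℕ) (S : Fin (m n) → (Fin n → ZMod (2 ^ logq n)) × ZMod (2 ^ logq n)), (∃ (s : Fin n → ZMod (2 ^ logq n)) (e : Fin (m n) → ℤ), (∀ j, (S j).2 = (∑ i, (S j).1 i * s i) + ((e j : ℤ) : ZMod (2 ^ logq n))) ∧ (∑ j, ((e j : ℤ) : ℝ) ^ 2) ≤ ((r n : ℕ) : ℝ) ^ 2) ∧ w = Literature.Computability.Cryptography.encodeLWESamples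 S}) ∧ (∀ t : ℕ, ∀ w ∈ (K₁ t).support, w ∈ {w : List Bool | ∃ (n : ℕ) (S : Fin (m n) → (Fin n → ZMod (2 ^ logq n)) × ZMod (2 ^ logq n)), (∃ (s : Fin n → ZMod (2 ^ logq n)) (e : Fin (m n) → ℤ), (∀ j, (S j).2 = (∑ i, (S j).1 i * s i) + ((e j : ℤ) : ZMod (2 ^ logq n))) ∧ (∑ j, ((e j : ℤ) : ℝ) ^ 2) ≤ ((r n : ℕ) : ℝ) ^ 2) ∧ w = Literature.Computability.Cryptography.encodeLWESamples S}) ∧ Literature.Computability.Cryptography.IsStatisticallyClose K₀ (fun n : ℕ => (Literature.Computability.Cryptography.LWE.uniformSamples (Fin n) (ZMod (2 ^ logq n)) (m n)).map Literature.Computability.Cryptography.encodeLWESamples) ∧ Literature.Computability.Cryptography.IsStatisticallyClose K₁ (fun n : ℕ => (Literature.Computability.Cryptography.LWE.lweSamplesUniformSecret (Literature.Computability.Cryptography.LWE.discretizedGaussian (2 ^ logq n) (α n)) (m n) : PMF (Fin (m n) → (Fin n → ZMod (2 ^ logq n)) × ZMod (2 ^ logq n))).map Literature.Computability.Cryptography.encodeLWESamples)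 := by
  sorry

/-- **STUB 3 · `stub_certBDD_karp_to_pea`** (L–XL, PROVABLE in print — K1').  Readable form `KarpStmt` =
`∀ logq m r R, Separated m r R → CertBDD logq m r R ≤ₚ PEA 3`.  The work: the 4-fold shift sampler
`(s, e', c) ↦ As + e' + c·b (mod 2^k)` from uniform bits (box noise half-width `β` = least power of two
`≥ 4√m·r`), its entropy dichotomy (FAR ∧ WELL-SPREAD: `H = 4(nk + m·log₂(2β) + 1)`, by disjoint translates and
injectivity since `2β√m ≤ 16 m r < R`; CLOSE: `H ≤ 4(nk + m·log₂(2β)) + 1/2`, by `I(c;Y) ≤ Δ ≤ ‖e₀‖₁/(2β) ≤ 1/8`),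
the threshold `k* = 4(nk + m·log₂(2β)) + 1 (+ encoding randomness)`, the logspace evaluation of the sampler and
its AIK PERFECT degree-3 randomized encoding over `F₂` (entropy `+` randomness length exactly; output as a
sparse `PolyMapF2` with `DegLE 3`), all inside one `FP` map on codes (`encodeLWESamples` header gives `n, q, m`;
`r n` from `1ⁿ` by `Separated.2`, `n ≤ |x|` as `m n ≥ 1`; degenerate headers ↦ fixed YES/NO instances of `PEA 3`,
which exist: `Theorems`' `H_iYes/H_iNo`).  Shares the AIK compile step with route item `PeaDegreeReduction`
(stmt-PneNP-10780).  Leans on: `PolynomialEntropyApproximation` (`PEA`, `PolyMapF2.entropy_prod`,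
`mapEntropy_of_injective`, `mapEntropy_comp_of_injOn`), `PEA_disjoint`; NOT in tree yet: AIK/IK randomized
encodings of branching programs (definition + perfectness), `I(c;Y) ≤ Δ`.
[DvirGutfreundRothblumVadhan2010, Thm. 4.5–4.6, §4.4; ApplebaumIshaiKushilevitz2006, Thm. 4.3;
GoldreichSahaiVadhan1999; CoverThomas2006, §2.10] -/
theorem stub_certBDD_karp_to_pea : ∀ (logq m r R : ℕ → ℕ), ((∀ n : ℕ, 1 ≤ r n ∧ 1 ≤ m n ∧ 64 * m n * r n ≤ R n) ∧ Literature.Computability.Complexity.PolyTimeComputable Computability.unaryEncodeNat Computability.encodeNat r) → Literature.Computability.Complexity.PromiseProblem.PolyTimeReducible (Literature.Computability.Complexity.PromiseProblem.mk {w : List Bool | ∃ (n : ℕ) (S : Fin (m n) → (Fin n → ZMod (2 ^ logq n)) × ZMod (2 ^ logq n)), (∃ (s : Fin n → ZMod (2 ^ logq n)) (e : Fin (m n) → ℤ), (∀ j, (S j).2 = (∑ i, (S j).1 i * s i) + ((e j : ℤ) : ZMod (2 ^ logq n))) ∧ (∑ j, ((e j : ℤ) : ℝ) ^ 2) ≤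 ((r n : ℕ) : ℝ) ^ 2) ∧ w = Literature.Computability.Cryptography.encodeLWESamples S} ({w : List Bool | ∃ (n : ℕ) (S : Fin (m n) → (Fin n → ZMod (2 ^ logq n)) × ZMod (2 ^ logq n)), (∀ (s : Fin n → ZMod (2 ^ logq n)) (e : Fin (m n) → ℤ), (∀ j, ((e j : ℤ) : ZMod (2 ^ logq n)) = ∑ i, (S j).1 i * s i) → (∑ j, ((e j : ℤ) : ℝ) ^ 2) < ((R n : ℕ) : ℝ) ^ 2 → s = 0 ∧ e = 0) ∧ (∀ (s : Fin n → ZMod (2 ^ logq n)) (e : Fin (m n) → ℤ), (∀ j, (S j).2 = (∑ i, (S j).1 i * s i) + ((e j : ℤ) : ZMod (2 ^ logq n))) → ((R n : ℕ) : ℝ) ^ 2 ≤ (∑ j, ((e j : ℤ) : ℝ) ^ 2)) ∧ w = Literature.Computability.Cryptography.encodeLWESamples S} \ {w : List Bool | ∃ (n : ℕ) (S : Fin (m n) → (Fin n → ZMod (2 ^ logq n)) × ZMod (2 ^ logq n)), (∃ (s : Fin n → ZMod (2 ^ logq n)) (e : Fin (m n) → ℤ), (∀ j, (S j).2 = (∑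 i, (S j).1 i * s i) + ((e j : ℤ) : ZMod (2 ^ logq n))) ∧ (∑ j, ((e j : ℤ) : ℝ) ^ 2) ≤ ((r n : ℕ) : ℝ) ^ 2) ∧ w = Literature.Computability.Cryptography.encodeLWESamples S})) (Literature.Computability.Complexity.PEA 3) := by
  sorry

/-! ## Consistency: each readable statement IS its registered stub (definitionally) -/

theorem captureStmt_holds : CaptureStmt := stub_pea_hard_captures_dlwe
theorem modesStmt_holds : ModesStmt := stub_trapdoor_certified_modes
theorem karpStmt_holds : KarpStmt := stub_certBDD_karp_to_pea

/-! ## Name-keyed aliases of the three statements (the hypotheses of the composition) -/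
namespace Registered

/-- Alias of `CaptureStmt` keyed by the registered stub name. -/
abbrev stub_pea_hard_captures_dlwe : Prop := CaptureStmt
/-- Alias of `ModesStmt` keyed by the registered stub name. -/
abbrev stub_trapdoor_certified_modes : Prop := ModesStmt
/-- Alias of `KarpStmt` keyed by the registered stub name. -/
abbrev stub_certBDD_karp_to_pea : Prop := KarpStmt

end Registered

/-! ## Proved glue: certified modes + LWE hardness ⇒ a hard samplable on-promise ensemble on `CertBDD` -/

/-- **The dual-mode step on `CertBDD`.** Samplable `K₀ ⊆ NO`, `K₁ ⊆ YES`, statistically close to the uniform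
resp. honest-LWE code ensembles, plus decision-LWE hardness, give a polynomial-time samplable ensemble
supported on the promise of `CertBDD` on which `CertBDD.yes ∉ HeurBPP` — the fair mixture `½K₀ + ½K₁`
(hybrid `K₀ ≈ₛ U ≈_c LWE ≈ₛ K₁`, then the landed `not_mem_HeurBPP_of_isCompIndistinguishable`).
[Goldreich2001, §3.2.3; BogdanovTrevisan2006, Def. 2.1, 2.12–2.13] -/
theorem exists_hard_samplable_certBDD {logq m r R : ℕ → ℕ} {α : ℕ → ℝ} {K₀ K₁ : Ensemble}
    (hK₀ : K₀.IsPolySamplable) (hK₁ : K₁.IsPolySamplable)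
    (hno : ∀ t : ℕ, ∀ w ∈ (K₀ t).support, w ∈ (CertBDD logq m r R).no)
    (hyes : ∀ t : ℕ, ∀ w ∈ (K₁ t).support, w ∈ (CertBDD logq m r R).yes)
    (hc₀ : IsStatisticallyClose K₀ (unifIdeal logq m)) (hc₁ : IsStatisticallyClose K₁ (lweIdeal logq m α))
    (hlwe : DLWEHard logq m α) :
    ∃ D : Ensemble, D.IsPolySamplable ∧
      (∀ t : ℕ, ∀ w ∈ (D t).support, w ∈ (CertBDD logq m r R).yes ∨ w ∈ (CertBDD logq m r R).no) ∧
      (⟨(CertBDD logq m r R).yes, D⟩ : DistProblem) ∉ HeurBPP := by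
  -- hybrid: K₀ ≈ₛ unifIdeal ≈_c lweIdeal ≈ₛ K₁
  have hind : IsCompIndistinguishable K₀ K₁ :=
    Literature.Computability.Cryptography.IsCompIndistinguishable.trans_holds
      (Literature.Computability.Cryptography.IsStatisticallyClose.isCompIndistinguishable_holds hc₀)
      (Literature.Computability.Cryptography.IsCompIndistinguishable.trans_holds hlwe.symm
        (Literature.Computability.Cryptography.IsStatisticallyClose.isCompIndistinguishable_holds hc₁.symm))
  refine ⟨mixEnsemble K₀ K₁, Ensemble.isPolySamplable_mixEnsemble hK₀ hK₁,
    Summit.PneNP.PneNP.Theorems.mixEnsemble_support_subset_promise hno hyes, ?_⟩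
  exact Summit.PneNP.PneNP.Theorems.not_mem_HeurBPP_of_isCompIndistinguishable (certBDD_disjoint logq m r R)
    hno hyes
    (fun n E => by simpa using toOuterMeasure_le_two_mul_mixEnsemble K₀ K₁ n E false)
    (fun n E => by simpa using toOuterMeasure_le_two_mul_mixEnsemble K₀ K₁ n E true) hind

/-! ## The composition: the three stubs imply the crux, BY NAME (no `sorry`) -/

/-- **`PeaWorstToAvg` from the three stubs.** STUB 2 supplies parameters `(logq, m, α, r, R)` with certified
modes; from the crux's hypothesis `PEA 3 ∉ PromiseBPP'`, STUB 1 gives decision-LWE hardness there;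
`exists_hard_samplable_certBDD` gives a samplable on-promise `HeurBPP`-hard ensemble on `CertBDD`; STUB 3 and the
landed push-forward `Theorems.peaWorstToAvg_of_hard_reducible` carry it into `PEA 3` and conclude the crux.
[DvirGutfreundRothblumVadhan2010, pp. 2–3; BogdanovTrevisan2006, Lemma 3.2] -/
theorem PeaWorstToAvg_of (h₁ : Registered.stub_pea_hard_captures_dlwe)
    (h₂ : Registered.stub_trapdoor_certified_modes) (h₃ : Registered.stub_certBDD_karp_to_pea) :
    Summit.PneNP.PneNP.Theses.SzkEntropy.PeaWorstToAvg := by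
  obtain ⟨logq, m, α, r, R, hreg, hsep, K₀, K₁, hK₀, hK₁, hno, hyes, hc₀, hc₁⟩ := h₂
  exact Summit.PneNP.PneNP.Theorems.peaWorstToAvg_of_hard_reducible fun hA =>
    ⟨CertBDD logq m r R, h₃ logq m r R hsep,
      exists_hard_samplable_certBDD hK₀ hK₁ hno hyes hc₀ hc₁ (h₁ logq m α hreg hA)⟩

/-- Wiring check: the registered stubs feed `PeaWorstToAvg_of` as stated. -/
example : Summit.PneNP.PneNP.Theses.SzkEntropy.PeaWorstToAvg :=
  PeaWorstToAvg_of stub_pea_hard_captures_dlwe stub_trapdoor_certified_modes stub_certBDD_karp_to_pea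

/-- **Unconditional reach of the line (lattice-hard world).** If decision-LWE is hard at STUB 2's parameters —
e.g. under the sibling route's worst-case lattice thesis via BLPRS — the crux holds outright AND so does its
hypothesis `PEA 3 ∉ PromiseBPP'` (converse `szkEntropy_peaWorstToAvg_converse`): STUBS 2 + 3 alone give
"decision-LWE (BLPRS regime) ⇒ `PeaWorstToAvg`", the card's conditional corollary, with exact support.
[DvirGutfreundRothblumVadhan2010, pp. 2–3, §4.4; BrakerskiEtAl2013, Thm. 1.1] -/
theorem peaWorstToAvg_of_modes_of_dlwe (h₂ : Registered.stub_trapdoor_certified_modes)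
    (h₃ : Registered.stub_certBDD_karp_to_pea)
    (hlwe : ∀ (logq m : ℕ → ℕ) (α : ℕ → ℝ), InRegime logq m α → DLWEHard logq m α) :
    Summit.PneNP.PneNP.Theses.SzkEntropy.PeaWorstToAvg ∧ PEA 3 ∉ PromiseBPP' := by
  obtain ⟨logq, m, α, r, R, hreg, hsep, K₀, K₁, hK₀, hK₁, hno, hyes, hc₀, hc₁⟩ := h₂
  exact Summit.PneNP.PneNP.Theorems.peaWorstToAvg_of_heurHard_reducible
    ⟨CertBDD logq m r R, h₃ logq m r R hsep,
      exists_hard_samplable_certBDD hK₀ hK₁ hno hyes hc₀ hc₁ (hlwe logq m α hreg)⟩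

end Summit.PneNP.PneNP.Cruxes.PeaWorstToAvg.LatticeImportTrapdoorSupport

end
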